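import Summits.CriticalPhenomena.PercolationContinuityZ3.Theorems.Transplant.SkelFrmBParamsFaceOriginsYQA
import Summits.CriticalPhenomena.PercolationContinuityZ3.Theorems.Transplant.PlanarSkeletonFrmDefs
import Summits.CriticalPhenomena.PercolationContinuityZ3.Theorems.Transplant.SkelPhiStepIDataNS
import HarnessLib
/-!
(F) VALUE LAYER, N2 twin (hp-8 g42, 2026-08-23; F-DISCHARGE-MAP-N2 G18 y′-face origin sizes `l1_yLF?`, `hyl_yLF : |yL|₁ ≤ YbF + 11·n_L`): `port_frm.py` text
of N1 `SkelNegBParamsFaceOriginsYLA` (p3-g13) over OriginsYQA-N2; kit radius `KS0.R'0` (J19); slot-floor read → hypothesis `hMR0`. Cell-free.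
NON-VACUITY: hypotheses = Step I at `(gT mk gx, f)`, `16·S_F ≤ M_L`, `hMR0`, signs.
builds on p205010 (kernel theorem, internal audit signed; external expert review pending); nothing here is a claim about the open node `SamePDropOfSkeletonFrm₁`.
N1 HEADER (kept for the reader):
# N1 params, M3 y′-FACE, group G-O′ (sizes, part 3) — **`|yLF?|₁ ≤ YbF + 11·n_L` AT ALL THREE y′ ORIGINS** (p1-g14's repaired `hyl` premise of
# `KS.hπ2Y_YA₂/hπ3Y_YA₂`, ZPiYA2 p326776; located p3-g12 10:38:35Z / stmt-g17 10:37:30Z): the d/t twins **`l1_yLFd`**, **`l1_yLFt`** of OriginsYQA's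
# `l1_yLFs` (`≤ YbF + U_L`, via the generic `l1_yLFof`), and the three corollaries **`hyl_yLFs/hyl_yLFd/hyl_yLFt : |yLF? 0| + |yLF? 1| ≤ YbF + 11·n_L`**
# (`U_L = n_L + |h_L| ≤ 11·n_L`), so the assembler's `hyl` is ONE `exact` per bridge case.  (stmt-g17 2026-08-22.)
builds on p205010 (kernel theorem, internal audit signed; external expert review pending) — nothing in this file uses p205010; NOTHING is claimed about the node
`SamePDropOfSkeletonNeg₁` (OPEN); lattice arithmetic only.
Lane `prim-bschramm-*`, seat `prim-bschramm-stmt` (gen 17); helper file (`--supports stmt-CriticalPhenomena-4575 --as helper`).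
[cite: KozmaNitzan2024, §4 Lemma 11 (pp. 22–23), Lemma 12 (pp. 23–25)] [cite: MartineauTassion2017, §4.1]
-/

noncomputable section

open scoped Classical

namespace Summit.CriticalPhenomena.PercolationContinuityZ3.Theorems.Transplant

namespace PlanarSkeletonFrm

namespace NegB

open Literature.Probability.Percolation Literature.Probability.LatticeModels SimpleGraph
open SkelConc (Consts)
open Skelφ (shearUnit shearUnit_pos sgnz sgnz_cases)
open Skelφ.StepI (DataN)
open TwoAxis.Para (modulus)
open Neg

namespace KS

section Sizes2

/-- The common bookkeeping of the d/t sizes: from the generic `l1_yLFof` bound with `|c₀| ≤ n_L + S_F + 5`, `|v′| ≤ 2n_L`, `|b₁| ≤ |h_L| + S_F + ℓ_L/2`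
to `YbF + U_L`. [folklore] -/
theorem l1_of_parts (κ : Consts) {V : Type} [DecidableEq V] [Countable V] {G : SimpleGraph V} [G.LocallyFinite] (Φ : PlanarSkeletonFrm G) (t : V) (p : unitInterval) (D : Skelφ.StepI.DataNS V) (c : ℕ) (mk : ℕ) (gx : Neg.FSlot) (f : ℕ) (hN : EqNumL κ Φ t p D (gT mk gx κ Φ t p D) f) {y0 y1 c₀ v' b₁ : ℤ}
    (hl : |y0| + |y1| ≤ |c₀| + |v'| + |b₁| + 2 * |hL κ Φ t p D (gT mk gx κ Φ t p D) f| + 1)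
    (hc₀ : |c₀| ≤ (nL κ Φ t p D (gT mk gx κ Φ t p D) f : ℤ) + ((SF κ Φ t p D c mk : ℕ) : ℤ) + 5)
    (hv' : |v'| ≤ 2 * (nL κ Φ t p D (gT mk gx κ Φ t p D) f : ℤ))
    (hb : |b₁| ≤ |hL κ Φ t p D (gT mk gx κ Φ t p D) f| + ((SF κ Φ t p D c mk : ℕ) : ℤ) + (ℓL κ Φ t p D (gT mk gx κ Φ t p D) f : ℤ) / 2) :
    (y0.natAbs + y1.natAbs : ℕ) ≤ YbF κ Φ t p D c mk (gT mk gx κ Φ t p D) f + shearUnit (nL κ Φ t p D (gT mk gx κ Φ t p D) f) (hL κ Φ t p D (gT mk gx κ Φ t p D) f) := by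
  obtain ⟨hn1, hℓ1⟩ := one_le_of_eqNumL κ Φ t p D _ f hN
  obtain ⟨g1, g2⟩ := PlanarSkeletonNeg.NegB.RootArith.floor_sandwich (x := (ℓL κ Φ t p D (gT mk gx κ Φ t p D) f : ℤ)) (d := 2) (by norm_num)
  have hY : (YbF κ Φ t p D c mk (gT mk gx κ Φ t p D) f : ℤ) = 2 * ((nL κ Φ t p D (gT mk gx κ Φ t p D) f : ℤ) + |hL κ Φ t p D (gT mk gx κ Φ t p D) f| +
      ℓL κ Φ t p D (gT mk gx κ Φ t p D) f + KS0.R'0 κ Φ t p D mk + ((SF κ Φ t p D c mk : ℕ) : ℤ) + 11) := by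
    unfold YbF; push_cast [Int.natCast_natAbs]; ring
  have hUe : (shearUnit (nL κ Φ t p D (gT mk gx κ Φ t p D) f) (hL κ Φ t p D (gT mk gx κ Φ t p D) f) : ℤ) =
      (nL κ Φ t p D (gT mk gx κ Φ t p D) f : ℤ) + |hL κ Φ t p D (gT mk gx κ Φ t p D) f| := by
    unfold Skelφ.shearUnit; push_cast [Int.natCast_natAbs]; ring
  have hR0 : (0 : ℤ) ≤ (KS0.R'0 κ Φ t p D mk : ℤ) := by positivity
  have hℓ0 : (0 : ℤ) ≤ (ℓL κ Φ t p D (gT mk gx κ Φ t p D) f : ℤ) := by positivity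
  rw [← Nat.cast_le (α := ℤ)]; push_cast [Int.natCast_natAbs]; rw [hY, hUe]
  linarith [abs_nonneg (hL κ Φ t p D (gT mk gx κ Φ t p D) f)]

/-- **`|yLFd|₁ ≤ YbF + U_L`** (steep transposed case; floor `16·S_F ≤ M_L` at `g := gT`; no `|h_L| ≤ 10n_L` needed). [folklore] -/
theorem l1_yLFd (κ : Consts) {V : Type} [DecidableEq V] [Countable V] {G : SimpleGraph V} [G.LocallyFinite] (Φ : PlanarSkeletonFrm G) (t : V) (p : unitInterval) (D : Skelφ.StepI.DataNS V) (c : ℕ) (mk : ℕ) (gx : Neg.FSlot) (f : ℕ) (hN : EqNumL κ Φ t p D (gT mk gx κ Φ t p D) f)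
    (hS : 16 * SF κ Φ t p D c mk ≤ ML κ Φ t p D (gT mk gx κ Φ t p D)) (hMR0 : 22000 * (KS0.R'0 κ Φ t p D mk + 2) ≤ ML κ Φ t p D (gT mk gx κ Φ t p D)) {σ σh : ℤ} (hσ : σ = 1 ∨ σ = -1) (hσh : σh = 1 ∨ σh = -1) :
    (yLFd κ Φ t p D c mk (gT mk gx κ Φ t p D) f σ σh 0).natAbs + (yLFd κ Φ t p D c mk (gT mk gx κ Φ t p D) f σ σh 1).natAbs ≤
      YbF κ Φ t p D c mk (gT mk gx κ Φ t p D) f + shearUnit (nL κ Φ t p D (gT mk gx κ Φ t p D) f) (hL κ Φ t p D (gT mk gx κ Φ t p D) f) := by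
  unfold yLFd
  obtain ⟨hn1, hℓ1⟩ := one_le_of_eqNumL κ Φ t p D _ f hN
  have hv : |vL κ Φ t p D (gT mk gx κ Φ t p D) f| ≤ nL κ Φ t p D (gT mk gx κ Φ t p D) f := hN.v_le
  have hSe := SF_int κ Φ t p D c mk
  have hS16 : 16 * (((SF κ Φ t p D c mk : ℕ) : ℤ)) ≤ (ML κ Φ t p D (gT mk gx κ Φ t p D) : ℤ) := by
    have h' : ((16 * SF κ Φ t p D c mk : ℕ) : ℤ) ≤ (ML κ Φ t p D (gT mk gx κ Φ t p D) : ℤ) := by exact_mod_cast hS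
    simpa only [Nat.cast_mul, Nat.cast_ofNat] using h'
  have h22 := (show 22000 * ((KS0.R'0 κ Φ t p D mk : ℤ) + 2) ≤ (ML κ Φ t p D (gT mk gx κ Φ t p D) : ℤ) by exact_mod_cast hMR0)
  have hMn := hN.n_le
  have hR0 : (0 : ℤ) ≤ (KS0.R'0 κ Φ t p D mk : ℤ) := by positivity
  have hnB0 : (0 : ℤ) ≤ (nBF κ Φ t p D c mk : ℤ) := by positivity
  have hℓB0 : (0 : ℤ) ≤ (ℓBF κ Φ t p D c mk : ℤ) := by positivity
  have hhB0 := abs_nonneg (hBF κ Φ t p D c mk)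
  have hh0 := abs_nonneg (hL κ Φ t p D (gT mk gx κ Φ t p D) f)
  obtain ⟨f1, f2⟩ := PlanarSkeletonNeg.NegB.RootArith.floor_sandwich (x := (ℓBF κ Φ t p D c mk : ℤ)) (d := 2) (by norm_num)
  obtain ⟨g1, g2⟩ := PlanarSkeletonNeg.NegB.RootArith.floor_sandwich (x := (ℓL κ Φ t p D (gT mk gx κ Φ t p D) f : ℤ)) (d := 2) (by norm_num)
  have hσh' : |σh| = 1 := by rcases hσh with h | h <;> simp [h]
  have hs' : |sgnz (hBF κ Φ t p D c mk)| = 1 := by rcases sgnz_cases (hBF κ Φ t p D c mk) with h | h <;> simp [h]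
  have hv' : |(nL κ Φ t p D (gT mk gx κ Φ t p D) f : ℤ) - KS0.R'0 κ Φ t p D mk + |hBF κ Φ t p D c mk| + nL κ Φ t p D (gT mk gx κ Φ t p D) f -
      ((nL κ Φ t p D (gT mk gx κ Φ t p D) f : ℤ) + |hBF κ Φ t p D c mk| + (ℓBF κ Φ t p D c mk : ℤ) / 2) + σ * σh * vL κ Φ t p D (gT mk gx κ Φ t p D) f| ≤
      2 * (nL κ Φ t p D (gT mk gx κ Φ t p D) f : ℤ) := by
    have h1 : |σ * σh * vL κ Φ t p D (gT mk gx κ Φ t p D) f| ≤ nL κ Φ t p D (gT mk gx κ Φ t p D) f := by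
      have hσ2 : |σ * σh| ≤ 1 := by rcases hσ with rfl | rfl <;> rcases hσh with rfl | rfl <;> norm_num
      rw [abs_mul]; nlinarith [abs_nonneg (vL κ Φ t p D (gT mk gx κ Φ t p D) f), abs_nonneg (σ * σh)]
    rw [abs_le] at h1 ⊢; constructor <;> linarith [h1.1, h1.2]
  have hl := l1_yLFof κ Φ t p D f _ hN hσh _ _ (σh * (hL κ Φ t p D (gT mk gx κ Φ t p D) f + sgnz (hBF κ Φ t p D c mk) * nBF κ Φ t p D c mk) +
      (ℓL κ Φ t p D (gT mk gx κ Φ t p D) f : ℤ) / 2) hv'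
  refine l1_of_parts κ Φ t p D c mk gx f hN hl ?_ hv' ?_
  · rw [abs_le]; constructor <;> linarith
  · calc _ ≤ |σh * (hL κ Φ t p D (gT mk gx κ Φ t p D) f + sgnz (hBF κ Φ t p D c mk) * nBF κ Φ t p D c mk)| + |(ℓL κ Φ t p D (gT mk gx κ Φ t p D) f : ℤ) / 2| := abs_add_le _ _
      _ ≤ _ := by
        rw [abs_mul, hσh', one_mul, abs_of_nonneg (by omega : (0:ℤ) ≤ (ℓL κ Φ t p D (gT mk gx κ Φ t p D) f : ℤ) / 2)]
        have h2 : |sgnz (hBF κ Φ t p D c mk) * (nBF κ Φ t p D c mk : ℤ)| = (nBF κ Φ t p D c mk : ℤ) := by rw [abs_mul, hs', one_mul, abs_of_nonneg hnB0]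
        linarith [abs_add_le (hL κ Φ t p D (gT mk gx κ Φ t p D) f) (sgnz (hBF κ Φ t p D c mk) * nBF κ Φ t p D c mk)]

/-- **`|yLFt|₁ ≤ YbF + U_L`** (flat transposed case; floor `16·S_F ≤ M_L` at `g := gT`). [folklore] -/
theorem l1_yLFt (κ : Consts) {V : Type} [DecidableEq V] [Countable V] {G : SimpleGraph V} [G.LocallyFinite] (Φ : PlanarSkeletonFrm G) (t : V) (p : unitInterval) (D : Skelφ.StepI.DataNS V) (c : ℕ) (mk : ℕ) (gx : Neg.FSlot) (f : ℕ) (hN : EqNumL κ Φ t p D (gT mk gx κ Φ t p D) f)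
    (hS : 16 * SF κ Φ t p D c mk ≤ ML κ Φ t p D (gT mk gx κ Φ t p D)) (hMR0 : 22000 * (KS0.R'0 κ Φ t p D mk + 2) ≤ ML κ Φ t p D (gT mk gx κ Φ t p D)) {σ σh : ℤ} (hσ : σ = 1 ∨ σ = -1) (hσh : σh = 1 ∨ σh = -1) :
    (yLFt κ Φ t p D c mk (gT mk gx κ Φ t p D) f σ σh 0).natAbs + (yLFt κ Φ t p D c mk (gT mk gx κ Φ t p D) f σ σh 1).natAbs ≤
      YbF κ Φ t p D c mk (gT mk gx κ Φ t p D) f + shearUnit (nL κ Φ t p D (gT mk gx κ Φ t p D) f) (hL κ Φ t p D (gT mk gx κ Φ t p D) f) := by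
  unfold yLFt
  obtain ⟨hn1, hℓ1⟩ := one_le_of_eqNumL κ Φ t p D _ f hN
  have hv : |vL κ Φ t p D (gT mk gx κ Φ t p D) f| ≤ nL κ Φ t p D (gT mk gx κ Φ t p D) f := hN.v_le
  have hSe := SF_int κ Φ t p D c mk
  have hS16 : 16 * (((SF κ Φ t p D c mk : ℕ) : ℤ)) ≤ (ML κ Φ t p D (gT mk gx κ Φ t p D) : ℤ) := by
    have h' : ((16 * SF κ Φ t p D c mk : ℕ) : ℤ) ≤ (ML κ Φ t p D (gT mk gx κ Φ t p D) : ℤ) := by exact_mod_cast hS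
    simpa only [Nat.cast_mul, Nat.cast_ofNat] using h'
  have h22 := (show 22000 * ((KS0.R'0 κ Φ t p D mk : ℤ) + 2) ≤ (ML κ Φ t p D (gT mk gx κ Φ t p D) : ℤ) by exact_mod_cast hMR0)
  have hMn := hN.n_le
  have hR0 : (0 : ℤ) ≤ (KS0.R'0 κ Φ t p D mk : ℤ) := by positivity
  have hnB0 : (0 : ℤ) ≤ (nBF κ Φ t p D c mk : ℤ) := by positivity
  have hℓB0 : (0 : ℤ) ≤ (ℓBF κ Φ t p D c mk : ℤ) := by positivity
  have hhB0 := abs_nonneg (hBF κ Φ t p D c mk)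
  have hh0 := abs_nonneg (hL κ Φ t p D (gT mk gx κ Φ t p D) f)
  obtain ⟨g1, g2⟩ := PlanarSkeletonNeg.NegB.RootArith.floor_sandwich (x := (ℓL κ Φ t p D (gT mk gx κ Φ t p D) f : ℤ)) (d := 2) (by norm_num)
  have hσh' : |σh| = 1 := by rcases hσh with h | h <;> simp [h]
  have hv' : |(nL κ Φ t p D (gT mk gx κ Φ t p D) f : ℤ) - KS0.R'0 κ Φ t p D mk + ((ℓBF κ Φ t p D c mk : ℤ) - |hBF κ Φ t p D c mk| - 11) + nL κ Φ t p D (gT mk gx κ Φ t p D) f -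
      ((nL κ Φ t p D (gT mk gx κ Φ t p D) f : ℤ) + ℓBF κ Φ t p D c mk - 5) + σ * σh * vL κ Φ t p D (gT mk gx κ Φ t p D) f| ≤
      2 * (nL κ Φ t p D (gT mk gx κ Φ t p D) f : ℤ) := by
    have h1 : |σ * σh * vL κ Φ t p D (gT mk gx κ Φ t p D) f| ≤ nL κ Φ t p D (gT mk gx κ Φ t p D) f := by
      have hσ2 : |σ * σh| ≤ 1 := by rcases hσ with rfl | rfl <;> rcases hσh with rfl | rfl <;> norm_num
      rw [abs_mul]; nlinarith [abs_nonneg (vL κ Φ t p D (gT mk gx κ Φ t p D) f), abs_nonneg (σ * σh)]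
    rw [abs_le] at h1 ⊢; constructor <;> linarith [h1.1, h1.2]
  have hl := l1_yLFof κ Φ t p D f _ hN hσh _ _ (σh * hL κ Φ t p D (gT mk gx κ Φ t p D) f + (ℓL κ Φ t p D (gT mk gx κ Φ t p D) f : ℤ) / 2) hv'
  refine l1_of_parts κ Φ t p D c mk gx f hN hl ?_ hv' ?_
  · rw [abs_le]; constructor <;> linarith
  · calc _ ≤ |σh * hL κ Φ t p D (gT mk gx κ Φ t p D) f| + |(ℓL κ Φ t p D (gT mk gx κ Φ t p D) f : ℤ) / 2| := abs_add_le _ _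
      _ ≤ _ := by
        rw [abs_mul, hσh', one_mul, abs_of_nonneg (by omega : (0:ℤ) ≤ (ℓL κ Φ t p D (gT mk gx κ Φ t p D) f : ℤ) / 2)]
        linarith [(le_trans (abs_nonneg _) (le_refl |hBF κ Φ t p D c mk|))]

/-- **p1's `hyl` at the three y′ origins**: `|yLF? 0| + |yLF? 1| ≤ YbF + 11·n_L` (`U_L ≤ 11·n_L`). [folklore] -/
theorem hyl_yLF (κ : Consts) {V : Type} [DecidableEq V] [Countable V] {G : SimpleGraph V} [G.LocallyFinite] (Φ : PlanarSkeletonFrm G) (t : V) (p : unitInterval) (D : Skelφ.StepI.DataNS V) (c : ℕ) (mk : ℕ) (gx : Neg.FSlot) (f : ℕ) (hN : EqNumL κ Φ t p D (gT mk gx κ Φ t p D) f) (hκ : (hL κ Φ t p D (gT mk gx κ Φ t p D) f).natAbs ≤ 10 * nL κ Φ t p D (gT mk gx κ Φ t p D) f)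
    (hS : 16 * SF κ Φ t p D c mk ≤ ML κ Φ t p D (gT mk gx κ Φ t p D)) (hMR0 : 22000 * (KS0.R'0 κ Φ t p D mk + 2) ≤ ML κ Φ t p D (gT mk gx κ Φ t p D)) {σ σh : ℤ} (hσ : σ = 1 ∨ σ = -1) (hσh : σh = 1 ∨ σh = -1) :
    ((yLFs κ Φ t p D c mk (gT mk gx κ Φ t p D) f σ σh 0).natAbs + (yLFs κ Φ t p D c mk (gT mk gx κ Φ t p D) f σ σh 1).natAbs ≤
        YbF κ Φ t p D c mk (gT mk gx κ Φ t p D) f + 11 * nL κ Φ t p D (gT mk gx κ Φ t p D) f) ∧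
      ((yLFd κ Φ t p D c mk (gT mk gx κ Φ t p D) f σ σh 0).natAbs + (yLFd κ Φ t p D c mk (gT mk gx κ Φ t p D) f σ σh 1).natAbs ≤
        YbF κ Φ t p D c mk (gT mk gx κ Φ t p D) f + 11 * nL κ Φ t p D (gT mk gx κ Φ t p D) f) ∧
      ((yLFt κ Φ t p D c mk (gT mk gx κ Φ t p D) f σ σh 0).natAbs + (yLFt κ Φ t p D c mk (gT mk gx κ Φ t p D) f σ σh 1).natAbs ≤
        YbF κ Φ t p D c mk (gT mk gx κ Φ t p D) f + 11 * nL κ Φ t p D (gT mk gx κ Φ t p D) f) := by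
  have hU : shearUnit (nL κ Φ t p D (gT mk gx κ Φ t p D) f) (hL κ Φ t p D (gT mk gx κ Φ t p D) f) ≤ 11 * nL κ Φ t p D (gT mk gx κ Φ t p D) f := by
    unfold Skelφ.shearUnit; omega
  have h1 := l1_yLFs κ Φ t p D c mk gx f hN hκ hS hMR0 hσ hσh
  have h2 := l1_yLFd κ Φ t p D c mk gx f hN hS hMR0 hσ hσh
  have h3 := l1_yLFt κ Φ t p D c mk gx f hN hS hMR0 hσ hσh
  exact ⟨by omega, by omega, by omega⟩

end Sizes2

end KS

end NegB

end PlanarSkeletonFrm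

end Summit.CriticalPhenomena.PercolationContinuityZ3.Theorems.Transplant

end
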